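import Summits.Ventures.HodgeRepro.Level3Witness
import Summits.Ventures.HodgeRepro.RouteCClauses

/-!
# Closer C5′ without the reduction: the discharge of a whole corner product `B = ∏_i A_{T i}` from the
printed clauses, multiplicities allowed (ROUTE.md §4 «Everything: C5′ (p = max(3k, g))»)

Blind re-derivation cell `pub-hodge-repro`, seat `night-1` (gen 2).  `RouteCClauses.routeC_closes_face` runs
Route C on the REDUCED product `B_red = ∏_k Simple (Φ k)` of a face and needs Lemma R (S3ᴿ) — hence
pairwise distinct `(cls i, tw i)` — to pull the Weil line back from `B_red`.  ROUTE.md §3.6 (ii) names the one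
degree-8 class Lemma R does not reach: the level-3 multiset `B₃ = A_{Φ̄}² × ∏_{j=1}^{4} A_{Φ^{(j)}}` (a repeated
corner), and §4's closer table prescribes for it «C5′ with k = 3, g = 24, p = 24».  This file writes that
REDUCTION-FREE form of C5′ once and for all: R1 + R3 + R4 make every corner's simple factor an Albanese factor
of Liu's `X_K` with unbounded multiplicity, R5 applied to the FATTENED family `T ⋆ : (Σ i, Fin |rstab (T i)|) →
Finset G` (the corner `A_{T i} ∼ Simple (T i)^{|rstab (T i)|}`, Shimura 1998 §8.2 / Milne 1999 Prop 2.1 as in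
`Vocab.Simple`'s docstring) gives a connected compact ball quotient of dimension `p ≥ g = dim B = |ι| · |G| / 2`
mapping onto `∏_i Simple (T i)^{|rstab (T i)|} ∼ B`, BMM Cor 2 at `(p, k)` and R7 give `HC_k` of it, and the
printed clause «the Weil line of a constant-sum corner product consists of Hodge classes» (Milne 2020 §2.1–2.2 =
Deligne LNM 900 §5 (c) / Thm 4.8) makes the Weil line algebraic.  No Lemma R, no injectivity: any `SumP k`
family of CM types, repeated corners allowed, at the price `p ≥ max (3k, |ι| · |G| / 2)` instead of
`max (3k, dim B_red)`.

* `card_rstab_dvd_card` — `|rstab Φ| ∣ |Φ|` for every `Φ ⊆ G` (kernel: `Φ` is a union of left cosets of its right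
  stabiliser), so `dim A_Φ = |G| / 2 = |rstab Φ| · dim Simple Φ` exactly (`sum_fatten_dim`);
* `SumP.card_eq_two_mul` — a `SumP k` family of CM types has exactly `2k` corners (double counting);
* `Vocab.WeilLine_Hodge` — the printed clause, with locators;
* `Vocab.ProdClauses p k` — the bundle of the reduction-free route (the seven clauses of `Clauses` other than
  Lemma R, plus `WeilLine_Hodge`);
* **`Vocab.routeC_closes_product`** — the discharge: for every finite `(G, c)` with `|G| ≥ 4`, every `SumP k`
  family `T` of CM types (`2k = |ι|`), `|ι| · |G| / 2 ≤ p`, `3k ≤ p`, `p + 1 ≥ 3`: `ProdClauses p k ⟹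
  WeilAlgebraic T`;
* `Vocab.face_weilAlgebraic_of_prodClauses` — every rank-four face through the reduction-free route, at
  `p = 2 |G|` (the cost of skipping Lemma R: `p = 16` on a degree-8 face instead of `6–8`);
* `level3Family c Φ π` / `sumP_three_level3Family` — the degree-8 level-3 family `(Φ̄, Φ̄, Φ^{(π₁)}, …, Φ^{(π₄)})`
  of ROUTE.md §3.6 (ii) for ANY `(G, c)` with four places and ANY CM type `Φ`, with `SumP 3` proved
  structurally; **`level3Family_weilAlgebraic`** — its discharge at `p = 24` (`ProdClauses 24 3`, Liu at rank
  `25`, BMM Cor 2 at `(24, 3)`, `3 ∉ ]8, 16[`) for every Galois CM field of degree 8 — the instance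
  ROUTE.md §4 prescribes, now a theorem for all five groups of order 8 at once;
* `level3Witness_weilAlgebraic` — typer g5's decic level-3 witness (`C₁₀`, six distinct corners, ROUTE.md §3.6
  (iii)) discharged at `p = 30` (`ProdClauses 30 3`).

Every theorem is the implication «printed clauses ⟹ the Weil line is algebraic»; BMM Cor 2 is printed-conditional
(O-R2.3).  Nothing here says anything about the status of the Hodge conjecture for CM abelian varieties, which is
NOT proved.
-/

set_option autoImplicit false

open Finset
open scoped Pointwise

namespace HodgeRepro

/-! ### The stabiliser order divides the size of the type: `dim A_Φ = |rstab Φ| · dim Simple Φ` -/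

section Stabiliser

variable {G : Type*} [Group G] [DecidableEq G] [Fintype G]

/-- The left coset `x · rstab Φ` as a finset. -/
def rstabCoset (Φ : Finset G) (x : G) : Finset G := univ.filter fun y => x⁻¹ * y ∈ rstab Φ

/-- Membership in the coset. -/
theorem mem_rstabCoset {Φ : Finset G} {x y : G} : y ∈ rstabCoset Φ x ↔ x⁻¹ * y ∈ rstab Φ := by
  simp [rstabCoset]

/-- Two cosets agree iff the points lie in the same coset. -/
theorem rstabCoset_eq_iff {Φ : Finset G} {x y : G} :
    rstabCoset Φ y = rstabCoset Φ x ↔ x⁻¹ * y ∈ rstab Φ := by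
  constructor
  · intro h
    have hy : y ∈ rstabCoset Φ y := by simp [mem_rstabCoset]
    rw [h] at hy
    exact mem_rstabCoset.1 hy
  · intro h
    ext z
    simp only [mem_rstabCoset]
    constructor
    · intro hz
      have := (rstab Φ).mul_mem h hz
      have e : x⁻¹ * y * (y⁻¹ * z) = x⁻¹ * z := by group
      rwa [e] at this
    · intro hz
      have := (rstab Φ).mul_mem ((rstab Φ).inv_mem h) hz
      have e : (x⁻¹ * y)⁻¹ * (x⁻¹ * z) = y⁻¹ * z := by group
      rwa [e] at this

/-- A coset of a point of `Φ` lies in `Φ` (`Φ h = Φ` for `h ∈ rstab Φ`). -/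
theorem rstabCoset_subset {Φ : Finset G} {x : G} (hx : x ∈ Φ) : rstabCoset Φ x ⊆ Φ := by
  intro y hy
  have h := mem_rstabCoset.1 hy
  rw [mem_rstab] at h
  have : y ∈ rmul Φ (x⁻¹ * y) := by
    rw [mem_rmul, mul_inv_rev, inv_inv, ← mul_assoc, mul_inv_cancel, one_mul]
    exact hx
  rwa [h] at this

/-- Every coset has `|rstab Φ|` elements. -/
theorem card_rstabCoset (Φ : Finset G) (x : G) : (rstabCoset Φ x).card = Fintype.card (rstab Φ) := by
  unfold rstabCoset
  rw [← Fintype.card_subtype]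
  refine Fintype.card_congr
    { toFun := fun y => ⟨x⁻¹ * y.1, y.2⟩
      invFun := fun h => ⟨x * h.1, by simp [h.2]⟩
      left_inv := fun y => by simp
      right_inv := fun h => by simp }

/-- **The order of the right stabiliser divides the size of the type**: `Φ` is a union of left cosets of
`rstab Φ`.  For a CM type `Φ` this is `dim A_Φ = |G| / 2 = |rstab Φ| · dim Simple Φ` (the corner `A_Φ` is
isogenous to the `|rstab Φ|`-th power of the simple variety `Simple Φ` of dimension `|G| / (2 |rstab Φ|)`). -/
theorem card_rstab_dvd_card (Φ : Finset G) : Fintype.card (rstab Φ) ∣ Φ.card := by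
  rw [card_eq_sum_card_fiberwise (f := rstabCoset Φ) (t := Φ.image (rstabCoset Φ))
    (fun x hx => mem_image_of_mem _ hx)]
  refine dvd_sum fun b hb => ?_
  obtain ⟨x, hx, rfl⟩ := mem_image.1 hb
  have : Φ.filter (fun y => rstabCoset Φ y = rstabCoset Φ x) = rstabCoset Φ x := by
    ext y
    simp only [mem_filter, rstabCoset_eq_iff, mem_rstabCoset]
    exact ⟨fun h => h.2, fun h => ⟨rstabCoset_subset hx (mem_rstabCoset.2 h), h⟩⟩
  rw [this, card_rstabCoset]

/-- For a CM type, `2 |rstab Φ|` divides `|G|`. -/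
theorem two_mul_card_rstab_dvd {c : G} (hc : IsComplexConj c) {Φ : Finset G} (hΦ : IsCMType c Φ) :
    2 * Fintype.card (rstab Φ) ∣ Fintype.card G := by
  rw [← hΦ.two_mul_card hc]
  exact Nat.mul_dvd_mul_left 2 (card_rstab_dvd_card Φ)

/-- `|rstab Φ| · (|G| / (2 |rstab Φ|)) = |G| / 2`: the corner has dimension `|G| / 2` whatever its stabiliser. -/
theorem card_rstab_mul_div {c : G} (hc : IsComplexConj c) {Φ : Finset G} (hΦ : IsCMType c Φ) :
    Fintype.card (rstab Φ) * (Fintype.card G / (2 * Fintype.card (rstab Φ))) = Fintype.card G / 2 := by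
  obtain ⟨q, hq⟩ := two_mul_card_rstab_dvd hc hΦ
  have hn : 0 < Fintype.card (rstab Φ) := Fintype.card_pos
  rw [hq, Nat.mul_div_cancel_left _ (by positivity), mul_assoc, Nat.mul_div_cancel_left _ two_pos]

end Stabiliser

/-! ### The fattened family and its dimension count -/

section Fatten

variable {G : Type*} [Group G] [DecidableEq G] [Fintype G]

/-- The fattened family of a corner family `T`: the corner `T i` repeated `|rstab (T i)|` times, so that
`SimpleProd (fatten T) = ∏_i Simple (T i)^{|rstab (T i)|}`, the reduced form of `B = ∏_i A_{T i}`
(`A_{T i} ∼ Simple (T i)^{|rstab (T i)|}`). -/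
def fatten {ι : Type} (T : ι → Finset G) : (Σ i : ι, Fin (Fintype.card (rstab (T i)))) → Finset G :=
  fun x => T x.1

/-- Every member of the fattened family is a CM type when every corner is. -/
theorem fatten_isCMType {ι : Type} {c : G} {T : ι → Finset G} (hT : ∀ i, IsCMType c (T i)) :
    ∀ x, IsCMType c (fatten T x) := fun x => hT x.1

/-- **The dimension of the corner product**: R5's sum over the fattened family is `|ι| · |G| / 2`. -/
theorem sum_fatten_dim {ι : Type} [Fintype ι] {c : G} (hc : IsComplexConj c) {T : ι → Finset G}
    (hT : ∀ i, IsCMType c (T i)) :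
    (∑ x : Σ i : ι, Fin (Fintype.card (rstab (T i))),
        Nat.card G / (2 * Nat.card (rstab (fatten T x)))) = Fintype.card ι * (Fintype.card G / 2) := by
  rw [Fintype.sum_sigma]
  simp only [fatten, sum_const, card_univ, Fintype.card_fin, smul_eq_mul, Nat.card_eq_fintype_card]
  rw [Finset.sum_congr rfl fun i _ => card_rstab_mul_div hc (hT i), sum_const, card_univ, smul_eq_mul]

end Fatten

/-! ### A `SumP k` family has `2k` corners -/

section SumPCard

variable {G : Type*} [Group G] [DecidableEq G] [Fintype G]

/-- Double counting: `Σ_i |T i| = Σ_x #{i : x ∈ T i}`, so a `SumP k` family of CM types has `|ι| · |G| / 2 = k |G|`,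
i.e. `|ι| = 2k`. -/
theorem SumP.card_eq_two_mul {ι : Type} [Fintype ι] {c : G} (hc : IsComplexConj c) {k : ℕ}
    {T : ι → Finset G} (hT : ∀ i, IsCMType c (T i)) (hsum : SumP k T) : Fintype.card ι = 2 * k := by
  have h1 : (∑ i, (T i).card) = ∑ x : G, (univ.filter fun i => x ∈ T i).card := by
    calc (∑ i, (T i).card) = ∑ i, ∑ x : G, (if x ∈ T i then 1 else 0) := by
          refine sum_congr rfl fun i _ => ?_
          rw [← Finset.card_filter (fun x => x ∈ T i) univ, Finset.filter_mem_eq_inter,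
            Finset.univ_inter]
      _ = ∑ x : G, ∑ i, (if x ∈ T i then 1 else 0) := sum_comm
      _ = ∑ x : G, (univ.filter fun i => x ∈ T i).card := by
          refine sum_congr rfl fun x _ => ?_
          rw [Finset.card_filter]
  rw [Finset.sum_congr rfl fun x _ => hsum x, sum_const, card_univ, smul_eq_mul] at h1
  have h2 : 2 * (∑ i, (T i).card) = Fintype.card ι * Fintype.card G := by
    rw [Finset.mul_sum, Finset.sum_congr rfl fun i _ => (hT i).two_mul_card hc, sum_const, card_univ,
      smul_eq_mul]
  have h3 : 0 < Fintype.card G := Fintype.card_pos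
  rw [h1] at h2
  have h4 : Fintype.card ι * Fintype.card G = (2 * k) * Fintype.card G := by rw [← h2]; ring
  exact Nat.eq_of_mul_eq_mul_right h3 h4

end SumPCard

namespace RouteC

namespace Vocab

variable {G : Type*} [Group G] [DecidableEq G] [Fintype G] {c : G} (V : Vocab G c)

/-! ### The printed clause: the Weil line of a constant-sum corner product consists of Hodge classes -/

/-- **The Weil line is a Hodge line, and the corner product is isogenous to `SimpleProd (fatten T)`**
(Milne 2020 arXiv:2010.08857 §2.1 p0004:L3–10, VERBATIM: «Let `A` be a complex abelian variety and `ν` a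
homomorphism from a CM-field `E` into `End⁰(A)`. The pair `(A,ν)` is said to be of Weil type if `H^{1,0}(A)` is
a free `E ⊗_ℚ ℂ`-module. In this case, `d := dim_E H¹(A,ℚ)` is even and the subspace `W_E(A) := ∧^d_E H¹(A,ℚ)`
of `H^d(A,ℚ)` consists of Hodge classes ([deligne1982], 4.4).»; §2.2 p0004:L24–29, VERBATIM: «(Deligne 1982, 5.)
Let `F` be a CM-algebra, let `φ₁,…,φ_{2p}` be CM-types on `F`, and let `A = ∏_i A_i`, where `A_i` is an abelian
variety of CM-type `(F,φ_i)`. If `Σ_i φ_i(s) = p` for all `s ∈ T := Hom(F,ℚ^al)`, then `A`, equipped with the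
diagonal action of `F`, is of split Weil type.»; the same in Deligne LNM 900 §5 (c) TeX pp.38–39 / Thm 4.8
TeX p.32, `SOURCES.md` rows D1 Thm 4.8 / M1 §2.2): for a corner family `T` of CM types of `E` with every
embedding in exactly `k = |ι| / 2` corners (`SumP k`), the `F`-line `W_F(B) = ∧^{2k}_F H¹(B,ℚ) ⊆ H^{2k}(B,ℚ)` of
`B = ∏_i A_{T i}` consists of Hodge classes, so `HC_k(B)` («every Hodge class in `H^{2k}(B,ℚ)` is algebraic»)
makes it algebraic; and `B ∼ ∏_i Simple (T i)^{|rstab (T i)|} = SimpleProd (fatten T)` (Shimura 1998 §8.2,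
Milne 1999 Prop 2.1 — `Vocab.Simple`'s docstring), an isogeny being a surjective morphism in both directions,
`HC_k` of the one is `HC_k` of the other (R7).  PRINTED (the Hodge-class clause) + ELEMENTARY (the isogeny
bookkeeping). -/
def WeilLine_Hodge : Prop :=
  ∀ {ι : Type} [Fintype ι] [DecidableEq ι] (T : ι → Finset G), (∀ i, IsCMType c (T i)) →
    SumP (Fintype.card ι / 2) T →
    V.HC (V.SimpleProd (fatten T)) (Fintype.card ι / 2) → V.WeilAlgebraic T

/-- The bundle of clauses of the REDUCTION-FREE route for a corner product of dimension `≤ p` in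
codimension `k`: the seven clauses of `Clauses p k` other than Lemma R, plus `WeilLine_Hodge`. -/
structure ProdClauses (p k : ℕ) : Prop where
  /-- BMM Cor 2 at `(p, k)` -/
  bmm : V.BMM2016_Cor2 p k
  /-- R7 in codimension `k` -/
  meng : V.Meng2019_Lemma4_1_codim k
  /-- DR Lemma 3.5 -/
  dr : V.DR2015_Lemma3_5
  /-- Liu Cor 4.20 at rank `p + 1` -/
  liu : V.Liu2021_Cor4_20 p
  /-- Liu Def 4.5 + Shimura §8.3 -/
  liuShimura : V.Liu2021_Def4_5_Shimura8_3
  /-- R5 at dimension `p` -/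
  r5 : V.RouteC_R5 p
  /-- isogeny bookkeeping -/
  isog : V.IsogFactorMult_of_isog_pow
  /-- the Weil line is a Hodge line on the corner product -/
  weil : V.WeilLine_Hodge

/-- The reduction-free bundle from the face bundle plus the Weil-line clause. -/
theorem ProdClauses.of_clauses {p k : ℕ} (H : V.Clauses p k) (hw : V.WeilLine_Hodge) :
    V.ProdClauses p k :=
  ⟨H.bmm, H.meng, H.dr, H.liu, H.liuShimura, H.r5, H.isog, hw⟩

/-! ### The discharge -/

/-- **The reduction-free discharge** (closer C5′ on the corner product itself, ROUTE.md §4 «Everything: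
C5′ (p = max(3k, g))»).  For `(G, c)` finite with `|G| ≥ 4` (R0), a family `T : ι → Finset G` of CM types with
every embedding in exactly `k = |ι| / 2` corners (`SumP`; repeated corners ALLOWED), `g = dim B = |ι| · |G| / 2 ≤ p`,
`3k ≤ p` and Liu's `n = p + 1 ≥ 3`: the printed clauses imply that the Weil line of `B = ∏_i A_{T i}` is
algebraic.  Chain: R1 + R3 + R4 (`albFactor_simple`) for every corner ⇒ R5 on the fattened family (dimension count
`sum_fatten_dim`) gives `S′ ↠ ∏_i Simple (T i)^{|rstab (T i)|}` ⇒ BMM Cor 2 gives `HC_k(S′)` ⇒ R7 transfers it ⇒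
the Weil-line clause concludes.  No Lemma R and no injectivity hypothesis. -/
theorem routeC_closes_product (hc : IsComplexConj c) {ι : Type} [Fintype ι] [DecidableEq ι]
    (T : ι → Finset G)
    (hT : ∀ i, IsCMType c (T i)) (hsum : SumP (Fintype.card ι / 2) T) (h0 : 4 ≤ Nat.card G)
    {p : ℕ} (hg : Fintype.card ι * (Fintype.card G / 2) ≤ p) (hk : 3 * (Fintype.card ι / 2) ≤ p)
    (hn : 3 ≤ p + 1) (H : V.ProdClauses p (Fintype.card ι / 2)) : V.WeilAlgebraic T := by
  -- R1 + R3 + R4: every corner's simple factor is an Albanese factor with unbounded multiplicity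
  have halb : ∀ (x : Σ i : ι, Fin (Fintype.card (rstab (T i)))) (m : ℕ),
      ∃ K : V.Level, V.IsogFactorMult (V.Alb (V.X p K)) (V.Simple (fatten T x)) m :=
    fun x m => V.albFactor_simple hc hn H.dr H.liu H.liuShimura H.isog (hT x.1) m
  -- R5 on the fattened family: a connected compact ball quotient of dimension `p` onto `∏ Simple (T i)^{n_i}`
  obtain ⟨S, hS, hsurj⟩ := H.r5 h0 (fatten T) (fatten_isCMType hT) halb
    (by rw [sum_fatten_dim hc hT]; exact hg)
  -- BMM Cor 2 on `S` in codimension `k`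
  have hrange : ¬ (p < 3 * (Fintype.card ι / 2) ∧ 3 * (Fintype.card ι / 2) < 2 * p) :=
    fun h => absurd hk (not_le.2 h.1)
  have hkp : Fintype.card ι / 2 ≤ p := by omega
  have hHC_S : V.HC S (Fintype.card ι / 2) := H.bmm hkp hrange S hS
  -- R7: transfer to the corner product
  have hHC_B : V.HC (V.SimpleProd (fatten T)) (Fintype.card ι / 2) :=
    H.meng S (V.SimpleProd (fatten T)) hsurj hHC_S
  -- the Weil line is a Hodge line on `B`
  exact H.weil T hT hsum hHC_B

/-- **Every rank-four face through the reduction-free route**: a face `(Φ; p, p′)` of any `(G, c)` with `|G| ≥ 4`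
is discharged from `ProdClauses (2 |G|) 2` — at the price `p = 2 |G| = dim B` (`16` in degree 8, `24` in
degree 12) instead of `max (6, dim B_red)` with Lemma R (`routeC_closes_face`). -/
theorem face_weilAlgebraic_of_prodClauses (hc : IsComplexConj c) {Φ : Finset G} (hΦ : IsCMType c Φ)
    {π π' : G} (hπ : π' ∉ place c π) (h0 : 4 ≤ Nat.card G)
    (H : V.ProdClauses (2 * Fintype.card G) 2) : V.WeilAlgebraic (faceCorners c Φ π π') := by
  have hsum : SumP (Fintype.card (Fin 4) / 2) (faceCorners c Φ π π') := by
    simpa [SumP, SumTwo] using sumTwo_faceCorners hc hΦ hπ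
  have h0' : 4 ≤ Fintype.card G := by rwa [Nat.card_eq_fintype_card] at h0
  obtain ⟨q, hq⟩ : 2 ∣ Fintype.card G := ⟨Φ.card, (hΦ.two_mul_card hc).symm⟩
  refine V.routeC_closes_product hc (faceCorners c Φ π π') (isCMType_faceCorners hc hΦ π π') hsum h0
    (p := 2 * Fintype.card G) ?_ (by simp; omega) (by omega) (by simpa using H)
  simp only [Fintype.card_fin, hq, Nat.mul_div_cancel_left _ two_pos]
  omega

end Vocab

end RouteC

/-! ### The degree-8 level-3 class of ROUTE.md §3.6 (ii): `B₃ = A_{Φ̄}² × ∏_j A_{Φ^{(π_j)}}` -/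

section Level3

variable {G : Type*} [Group G] [DecidableEq G] [Fintype G]

/-- The level-3 family of a CM type `Φ` and four place representatives `π : Fin 4 → G`:
`(Φ̄, Φ̄, Φ^{(π 0)}, Φ^{(π 1)}, Φ^{(π 2)}, Φ^{(π 3)})` — ROUTE.md §3.6 (ii)'s representative
`{Φ̄, Φ̄, Φ^{(1)}, Φ^{(2)}, Φ^{(3)}, Φ^{(4)}}` (the conjugate type twice and the four single flips). -/
def level3Family (c : G) (Φ : Finset G) (π : Fin 4 → G) : Fin 6 → Finset G :=
  ![c • Φ, c • Φ, flipAt c (π 0) Φ, flipAt c (π 1) Φ, flipAt c (π 2) Φ, flipAt c (π 3) Φ]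

/-- `π` enumerates the places: every embedding lies in the place of exactly one `π j`. -/
def IsPlaceEnum (c : G) (π : Fin 4 → G) : Prop :=
  ∀ x : G, (univ.filter fun j => x ∈ place c (π j)).card = 1

/-- `IsPlaceEnum` is decidable. -/
instance (c : G) (π : Fin 4 → G) : Decidable (IsPlaceEnum c π) := by
  unfold IsPlaceEnum; infer_instance

/-- Every member of the level-3 family is a CM type. -/
theorem isCMType_level3Family {c : G} (hc : IsComplexConj c) {Φ : Finset G} (hΦ : IsCMType c Φ)
    (π : Fin 4 → G) (i : Fin 6) : IsCMType c (level3Family c Φ π i) := by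
  fin_cases i
  · exact hΦ.conj hc
  · exact hΦ.conj hc
  · exact hΦ.flipAt hc _
  · exact hΦ.flipAt hc _
  · exact hΦ.flipAt hc _
  · exact hΦ.flipAt hc _

/-- **Every embedding lies in exactly three members of the level-3 family** (`SumP 3`, the `(eq2)`-condition
at level 3): `x ∈ Φ` lies in no `Φ̄` and in the three flips away from its place; `x ∉ Φ` lies in both copies
of `Φ̄` and in the one flip at its place. -/
theorem sumP_three_level3Family {c : G} (hc : IsComplexConj c) {Φ : Finset G} (hΦ : IsCMType c Φ)
    {π : Fin 4 → G} (hπ : IsPlaceEnum c π) : SumP 3 (level3Family c Φ π) := by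
  intro x
  have h1 := hπ x
  rw [Finset.card_filter, Fin.sum_univ_four] at h1
  have e0 : level3Family c Φ π 0 = c • Φ := rfl
  have e1 : level3Family c Φ π 1 = c • Φ := rfl
  have e2 : level3Family c Φ π 2 = flipAt c (π 0) Φ := rfl
  have e3 : level3Family c Φ π 3 = flipAt c (π 1) Φ := rfl
  have e4 : level3Family c Φ π 4 = flipAt c (π 2) Φ := rfl
  have e5 : level3Family c Φ π 5 = flipAt c (π 3) Φ := rfl
  rw [Finset.card_filter, Fin.sum_univ_six, e0, e1, e2, e3, e4, e5]
  simp only [mem_flipAt, hΦ.smul_eq_compl hc, Finset.mem_compl]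
  by_cases ha : x ∈ Φ <;> by_cases h0 : x ∈ place c (π 0) <;> by_cases h1' : x ∈ place c (π 1) <;>
    by_cases h2 : x ∈ place c (π 2) <;> by_cases h3 : x ∈ place c (π 3) <;>
    simp [ha, h0, h1', h2, h3] at h1 ⊢

/-- **The degree-8 level-3 class discharged by the reduction-free C5′ at `p = 24`** (ROUTE.md §4's closer table:
«the degree-8 level-3 class §3.6 (ii): C5′ with k = 3, g = 24, p = 24 (Liu at n = 25, conditional through
R2.3)»).  For EVERY `(G, c)` of order 8 (the five Galois groups C8, C4 × C2, C2³, D4, Q8), every CM type `Φ` and every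
enumeration `π` of the four places: `ProdClauses 24 3` implies that the Weil line of the 24-fold
`B₃ = A_{Φ̄}² × ∏_j A_{Φ^{(π_j)}}` is algebraic.  Lemma R is not used (the repeated corner `Φ̄` would violate its
injectivity hypothesis); BMM Cor 2 enters at `(24, 3)`, `3 ∉ ]8, 16[`. -/
theorem level3Family_weilAlgebraic {c : G} (hc : IsComplexConj c) (h8 : Fintype.card G = 8)
    {Φ : Finset G} (hΦ : IsCMType c Φ) {π : Fin 4 → G} (hπ : IsPlaceEnum c π)
    (V : RouteC.Vocab G c) (H : V.ProdClauses 24 3) : V.WeilAlgebraic (level3Family c Φ π) := by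
  have hsum : SumP (Fintype.card (Fin 6) / 2) (level3Family c Φ π) := by
    simpa using sumP_three_level3Family hc hΦ hπ
  refine V.routeC_closes_product hc (level3Family c Φ π) (isCMType_level3Family hc hΦ π) hsum
    (by rw [Nat.card_eq_fintype_card, h8]; norm_num) (p := 24) (by simp [h8]) (by simp) (by norm_num)
    (by simpa using H)

end Level3

/-! ### The decic level-3 witness (ROUTE.md §3.6 (iii), typer g5) -/

/-- **typer g5's decic level-3 witness discharged at `p = 30`**: the six pairwise distinct CM types of `(C₁₀, 5)`
with every embedding in exactly three of them (`level3Witness_sumThree`) — a 30-fold with `k = 3` — from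
`ProdClauses 30 3` (Liu at rank `31`, BMM Cor 2 at `(30, 3)`, `3 ∉ ]10, 20[`). -/
theorem level3Witness_weilAlgebraic (V : RouteC.Vocab C10 cc_C10) (H : V.ProdClauses 30 3) :
    V.WeilAlgebraic level3Witness := by
  have hsum : SumP (Fintype.card (Fin 6) / 2) level3Witness := by
    simpa using level3Witness_sumThree
  refine V.routeC_closes_product cc_C10_isComplexConj level3Witness level3Witness_isCMType hsum
    (by rw [Nat.card_eq_fintype_card]; decide) (p := 30) (by decide) (by simp) (by norm_num)
    (by simpa using H)

end HodgeRepro
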